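import Literature.Analysis.Complex.RectangleResiduePolarParts
import Literature.Analysis.Complex.VerticalLineShift
import HarnessLib

/-!
# Shifting a vertical line of integration across finitely many poles of finite order

Trunk support (`Literature/Analysis/Complex`). The tree moves absolutely convergent vertical-line integrals
across a pole-free strip (`Literature.Analysis.Complex.integral_vertical_eq_of_differentiableOn`, file
`VerticalLineShift.lean`) and, for Perron inversion of Beurling zeta functions, across finitely many REAL
SIMPLE poles (`Literature.NumberTheory.BeurlingPrimes.perron_integral_eq_residues_add`, `PerronShift.lean`).
This file gives the general finite version — finitely many poles of arbitrary finite order anywhere in the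
open strip — as needed for the Perron inversion of Broucke–Debruyne–Révész (2023, proof of Theorem 3.2,
(3.7)–(3.8)), where the continued zeta function `E_M(s)e^{Z(s)}` has the prescribed complex poles `ω ∈ 𝒮`
with multiplicities `m(ω)`:

* `Literature.Analysis.Complex.integral_vertical_sub_eq_sum_of_poles_dslope` — let `σ₁ < κ`,
  `U ⊇ {σ₁ ≤ Re s ≤ κ}` open, `S` a finite set of points with `σ₁ < Re p < κ`, `F` differentiable on `U ∖ S`
  with `F(z) = φ_p(z)/(z − p)^{n(p)+1}` near each `p ∈ S` (`φ_p` differentiable near `p`), `F` integrable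
  along `Re s = σ₁` and `Re s = κ`, and `sup_{u ∈ [σ₁,κ]} ‖F(u + iT)‖ → 0` as `|T| → ∞`. Then
  `∫ F(κ+it) dt − ∫ F(σ₁+it) dt = 2π Σ_{p ∈ S} ((swap dslope p)^[n p] φ_p) p`
  (lines parametrised by `t ↦ u + it`, so `∫_{(u)} F(s) ds = i ∫ F(u+it) dt`);
* `Literature.Analysis.Complex.integral_vertical_sub_eq_sum_of_poles` — the same with the residues written as
  derivatives, `φ_p^{(n(p))}(p)/n(p)!`.

Proof: the residue theorem on `[σ₁, κ] × [−T, T]` for `T` above all the poles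
(`Literature.Analysis.Complex.rectBoundaryIntegral_eq_sum_of_poles`), then `T → ∞`: the horizontal sides are
`≤ (κ − σ₁)·sup → 0` and the vertical sides tend to the line integrals
(`MeasureTheory.intervalIntegral_tendsto_integral`). Standard (Titchmarsh, *Theory of Functions*, §3.12;
BDR 2023: "We transfer the integration contour … By the residue theorem we get …"); tagged folklore.

## References

* J. B. Conway, *Functions of One Complex Variable I*, 2nd ed., GTM 11, Springer 1978, Ch. V §2. [Conway1978]
* F. Broucke, G. Debruyne, Sz. Gy. Révész, *Some examples of well-behaved Beurling number systems*,
  arXiv:2309.01567, proof of Theorem 3.2, (3.7)–(3.8). [BrouckeDebruyneRevesz2023]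
-/

noncomputable section

open _root_.Complex Set MeasureTheory Filter intervalIntegral Real
open scoped _root_.Topology

namespace Literature.Analysis.Complex

/-- Uniformly small integrands have small integrals over `[σ₁, κ]`: the horizontal sides tend to `0`.
[folklore] -/
theorem tendsto_horizontal_integral_of_decay {F : ℂ → ℂ} {σ₁ κ : ℝ} (hσκ : σ₁ ≤ κ)
    (hdecay : ∀ ε : ℝ, 0 < ε → ∃ T₀ : ℝ, ∀ T : ℝ, T₀ ≤ |T| → ∀ u ∈ Icc σ₁ κ, ‖F (u + T * I)‖ ≤ ε) :
    Tendsto (fun T : ℝ ↦ ∫ x in σ₁..κ, F (x + T * I)) atTop (𝓝 0) ∧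
      Tendsto (fun T : ℝ ↦ ∫ x in σ₁..κ, F (x + ((-T : ℝ) : ℂ) * I)) atTop (𝓝 0) := by
  have hba : 0 ≤ κ - σ₁ := sub_nonneg.2 hσκ
  have key : ∀ ε : ℝ, 0 < ε → ∃ T₀ : ℝ, ∀ T : ℝ, T₀ ≤ |T| → ‖∫ x in σ₁..κ, F (x + T * I)‖ < ε := by
    intro ε hε
    set ε' : ℝ := ε / (κ - σ₁ + 1) with hε'
    have hε'0 : 0 < ε' := div_pos hε (by linarith)
    obtain ⟨T₀, hT₀⟩ := hdecay ε' hε'0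
    refine ⟨T₀, fun T hT ↦ ?_⟩
    have h : ‖∫ x in σ₁..κ, F (x + T * I)‖ ≤ ε' * |κ - σ₁| :=
      norm_integral_le_of_norm_le_const fun x hx ↦
        hT₀ T hT x (by rw [uIoc_of_le hσκ] at hx; exact ⟨hx.1.le, hx.2⟩)
    rw [abs_of_nonneg hba] at h
    calc ‖∫ x in σ₁..κ, F (x + T * I)‖ ≤ ε' * (κ - σ₁) := h
      _ < ε := by
          have : ε' * (κ - σ₁ + 1) = ε := by rw [hε']; field_simp
          nlinarith
  constructor
  · rw [Metric.tendsto_atTop]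
    intro ε hε
    obtain ⟨T₀, hT₀⟩ := key ε hε
    refine ⟨max T₀ 0, fun T hT ↦ ?_⟩
    have hT0 : 0 ≤ T := le_of_max_le_right hT
    rw [dist_zero_right]
    exact hT₀ T (by rw [abs_of_nonneg hT0]; exact le_of_max_le_left hT)
  · rw [Metric.tendsto_atTop]
    intro ε hε
    obtain ⟨T₀, hT₀⟩ := key ε hε
    refine ⟨max T₀ 0, fun T hT ↦ ?_⟩
    have hT0 : 0 ≤ T := le_of_max_le_right hT
    rw [dist_zero_right]
    exact hT₀ (-T) (by rw [abs_neg, abs_of_nonneg hT0]; exact le_of_max_le_left hT)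

/-- **Shifting a vertical line of integration across finitely many poles of finite order** (residues as
`dslope`-Taylor coefficients `((swap dslope p)^[n p] φ_p) p`). See the module docstring. [folklore] -/
theorem integral_vertical_sub_eq_sum_of_poles_dslope {F : ℂ → ℂ} {σ₁ κ : ℝ} (hσκ : σ₁ < κ) (S : Finset ℂ)
    (n : ℂ → ℕ) (φ : ℂ → ℂ → ℂ) (U : Set ℂ) (hU : IsOpen U) (hUS : re ⁻¹' Icc σ₁ κ ⊆ U)
    (hS : ∀ p ∈ S, σ₁ < p.re ∧ p.re < κ) (hF : DifferentiableOn ℂ F (U \ ↑S))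
    (hpole : ∀ p ∈ S, ∃ V ∈ 𝓝 p, DifferentiableOn ℂ (φ p) V ∧
        ∀ z ∈ V, z ≠ p → F z = φ p z / (z - p) ^ (n p + 1))
    (hintκ : Integrable fun t : ℝ ↦ F (κ + t * I)) (hintσ : Integrable fun t : ℝ ↦ F (σ₁ + t * I))
    (hdecay : ∀ ε : ℝ, 0 < ε → ∃ T₀ : ℝ, ∀ T : ℝ, T₀ ≤ |T| → ∀ u ∈ Icc σ₁ κ, ‖F (u + T * I)‖ ≤ ε) :
    (∫ t : ℝ, F (κ + t * I)) - ∫ t : ℝ, F (σ₁ + t * I) =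
      2 * π * ∑ p ∈ S, (Function.swap dslope p)^[n p] (φ p) p := by
  classical
  set res : ℂ := ∑ p ∈ S, (Function.swap dslope p)^[n p] (φ p) p with hres
  -- a height above all the poles
  set T₁ : ℝ := (∑ p ∈ S, |p.im|) + 1 with hT₁def
  have hT₁ : ∀ p ∈ S, |p.im| < T₁ := fun p hp ↦ by
    have h := Finset.single_le_sum (f := fun q : ℂ ↦ |q.im|) (fun q _ ↦ abs_nonneg q.im) hp
    linarith
  have hT₁pos : 0 < T₁ := by
    have : 0 ≤ ∑ p ∈ S, |p.im| := Finset.sum_nonneg fun q _ ↦ abs_nonneg q.im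
    linarith
  -- the residue theorem on `[σ₁, κ] × [−T, T]`, `T ≥ T₁`
  have hrect : ∀ T : ℝ, T₁ ≤ T → rectBoundaryIntegral F σ₁ κ (-T) T = 2 * π * I * res := by
    intro T hT
    have hTT : -T < T := by linarith
    have hKU : Icc σ₁ κ ×ℂ Icc (-T) T ⊆ U := fun z hz ↦ hUS hz.1
    have hS' : ((S : Set ℂ) ⊆ Ioo σ₁ κ ×ℂ Ioo (-T) T) := by
      intro p hp
      have hp' : p ∈ S := by simpa using hp
      have h1 := hS p hp'
      have h2 := abs_lt.1 (lt_of_lt_of_le (hT₁ p hp') hT)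
      exact ⟨h1, ⟨h2.1, h2.2⟩⟩
    exact rectBoundaryIntegral_eq_sum_of_poles hσκ hTT S F n φ U hU hKU hS' hF hpole
  -- the vertical sides converge to the line integrals
  have hright : Tendsto (fun T : ℝ ↦ ∫ y in (-T)..T, F (κ + y * I)) atTop (𝓝 (∫ y : ℝ, F (κ + y * I))) :=
    intervalIntegral_tendsto_integral hintκ tendsto_neg_atTop_atBot tendsto_id
  have hleft : Tendsto (fun T : ℝ ↦ ∫ y in (-T)..T, F (σ₁ + y * I)) atTop (𝓝 (∫ y : ℝ, F (σ₁ + y * I))) :=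
    intervalIntegral_tendsto_integral hintσ tendsto_neg_atTop_atBot tendsto_id
  -- the horizontal sides tend to zero
  obtain ⟨htop, hbot⟩ := tendsto_horizontal_integral_of_decay hσκ.le hdecay
  -- pass to the limit in the rectangle identity
  have hlim0 := ((hbot.sub htop).add (hright.const_mul I)).sub (hleft.const_mul I)
  have hlim : Tendsto (fun T : ℝ ↦ rectBoundaryIntegral F σ₁ κ (-T) T) atTop
      (𝓝 (0 - 0 + I * (∫ y : ℝ, F (κ + y * I)) - I * (∫ y : ℝ, F (σ₁ + y * I)))) := by
    refine hlim0.congr' (Eventually.of_forall fun T ↦ ?_)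
    simp only [rectBoundaryIntegral_def, ofReal_neg]
  have hconst : Tendsto (fun T : ℝ ↦ rectBoundaryIntegral F σ₁ κ (-T) T) atTop (𝓝 (2 * π * I * res)) := by
    refine tendsto_const_nhds.congr' ?_
    filter_upwards [eventually_ge_atTop T₁] with T hT
    exact (hrect T hT).symm
  have heq := tendsto_nhds_unique hlim hconst
  simp only [zero_sub, neg_zero, zero_add] at heq
  apply mul_left_cancel₀ I_ne_zero
  linear_combination heq

/-- **Shifting a vertical line of integration across finitely many poles of finite order** (residues as
derivatives): under the hypotheses of `integral_vertical_sub_eq_sum_of_poles_dslope`,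
`∫ F(κ+it) dt − ∫ F(σ₁+it) dt = 2π Σ_{p∈S} φ_p^{(n(p))}(p)/n(p)!`. [folklore] -/
theorem integral_vertical_sub_eq_sum_of_poles {F : ℂ → ℂ} {σ₁ κ : ℝ} (hσκ : σ₁ < κ) (S : Finset ℂ)
    (n : ℂ → ℕ) (φ : ℂ → ℂ → ℂ) (U : Set ℂ) (hU : IsOpen U) (hUS : re ⁻¹' Icc σ₁ κ ⊆ U)
    (hS : ∀ p ∈ S, σ₁ < p.re ∧ p.re < κ) (hF : DifferentiableOn ℂ F (U \ ↑S))
    (hpole : ∀ p ∈ S, ∃ V ∈ 𝓝 p, DifferentiableOn ℂ (φ p) V ∧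
        ∀ z ∈ V, z ≠ p → F z = φ p z / (z - p) ^ (n p + 1))
    (hintκ : Integrable fun t : ℝ ↦ F (κ + t * I)) (hintσ : Integrable fun t : ℝ ↦ F (σ₁ + t * I))
    (hdecay : ∀ ε : ℝ, 0 < ε → ∃ T₀ : ℝ, ∀ T : ℝ, T₀ ≤ |T| → ∀ u ∈ Icc σ₁ κ, ‖F (u + T * I)‖ ≤ ε) :
    (∫ t : ℝ, F (κ + t * I)) - ∫ t : ℝ, F (σ₁ + t * I) =
      2 * π * ∑ p ∈ S, iteratedDeriv (n p) (φ p) p / ((n p).factorial : ℂ) := by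
  rw [integral_vertical_sub_eq_sum_of_poles_dslope hσκ S n φ U hU hUS hS hF hpole hintκ hintσ hdecay]
  congr 1
  refine Finset.sum_congr rfl fun p hp ↦ ?_
  obtain ⟨V, hV, hφ, -⟩ := hpole p hp
  exact iterate_dslope_apply_eq_iteratedDeriv_div hV hφ (n p)

/-- The decay hypothesis from a **polynomially controlled bound**: if `‖F(u + iT)‖ ≤ g(|T|)` for `u ∈ [σ₁, κ]`,
`|T| ≥ T₀`, with `g → 0` at `+∞`, then `sup_{u} ‖F(u+iT)‖ → 0`. [folklore] -/
theorem decay_of_bound {F : ℂ → ℂ} {σ₁ κ : ℝ} {g : ℝ → ℝ} {T₀ : ℝ}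
    (hbound : ∀ T : ℝ, T₀ ≤ |T| → ∀ u ∈ Icc σ₁ κ, ‖F (u + T * I)‖ ≤ g |T|)
    (hg : Tendsto g atTop (𝓝 0)) :
    ∀ ε : ℝ, 0 < ε → ∃ T₁ : ℝ, ∀ T : ℝ, T₁ ≤ |T| → ∀ u ∈ Icc σ₁ κ, ‖F (u + T * I)‖ ≤ ε := by
  intro ε hε
  have h := (Metric.tendsto_atTop.1 hg) ε hε
  obtain ⟨N, hN⟩ := h
  refine ⟨max T₀ N, fun T hT u hu ↦ ?_⟩
  have h1 := hbound T (le_trans (le_max_left _ _) hT) u hu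
  have h2 := hN |T| (le_trans (le_max_right _ _) hT)
  rw [Real.dist_eq, sub_zero] at h2
  exact h1.trans (le_trans (le_abs_self _) h2.le)

end Literature.Analysis.Complex
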